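import Literature.MathematicalPhysics.QuantumFieldTheory.Balaban1983to89.B13Sect1Arith
import Literature.MathematicalPhysics.QuantumFieldTheory.Balaban1983to89.B13ExpansionOrder

/-!
# NE9Lemma1RemainderPiece — the per-piece bound of leaf S5 for the DISPLAYED species AT FORM LEVEL: the (1.23)-contour
# functional of the FIFTH-ORDER TAYLOR REMAINDER of an analytic old term along the contour directions is bounded by
# `(1/r)·e^{−(κ₁−1)N}·2⁵·M·(a/R)⁵` — (I.3.54) ⊕ [II] (1.24) from analyticity + Schwarz + `B13Sect1Arith.bound_124`
# (cell `pub-balaban`, T4-DAG §2 node U3 / §6 NE9; lineage t4-ne9-p1 = row NE9 OWNER, generation 23; companion of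
# `NE9Lemma1Gather`/`NE9Lemma1Counting`/`NE9Lemma1CountingEval`/`NE9Lemma1Gain`)

HONEST FRAMING (T4-DAG PAGE 1).  Rung (B)+1 of the FINITE-VOLUME T⁴ programme — NOT infinite volume, NOT a mass gap, NOT the
Clay problem.  NE9 (`T4OutputRate.NE9` ∧ `FadingMemory`) is a cell NEW ESTIMATE, NOT PRINTED, NOT discharged here; spine 0/9.
HONEST DEPENDENCY (cell line, verbatim): continuum YM on T⁴ ⇐ BetaPertH ∧ nine spine estimates (0/9 proved); BetaPertH ⇐ (D1)
∧ (D4) ∧ CAP+tail; G-an2-4 gates asym, D1 and NE2/3/4.  `FlowStep.BetaPertH`, (B), (B^μ) do not occur.  [I] = [Balaban1987RG1]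
(CMP **109**), [II] = [Balaban1988RG2Cluster] (CMP **116**) are quoted for TYPES only (ABSOLUTE RULE: nothing printed in the
audited series is asserted).

WHERE THIS SITS.  `NE9Lemma1Counting.channelSizeAtStepNN_piece` / `NE9Lemma1Gain.channelSizeAtStepNN_pieceG` (this lineage,
gen 23) derive the NE9 frame's per-creation-step size binder S5 for every channel of the printed (1.23)/(1.33)-piece form from
ONE displayed per-piece bound `PieceBound(G)` of the (1.24)×(1.25) shape, `|piece(f)| ≤ Kp·N·gain·e^{−κd_j(X)}·exp(…)`.  For the
DISPLAYED family of [II] §1 — the piece (1.23) p. 7 built on *"the last term on the right-hand side of (I.3.34)"* (p. 2), i.e.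
on the FIFTH-ORDER TAYLOR REMAINDER of [I] (3.34) p. 277 — that bound is [II] (1.24) *"|(1.23)| ≦ 8B₀C₁e^{16κ₁}α₂⁻¹g_k|B|E₀
(α₁/α₃)⁵(L^jη)⁵·exp(−(κ₁−1)M⁻⁴|Y₀∖□̃⁴|)exp(−κd_j(X))"*, obtained from [I] (3.54) (the remainder bound, *"We were doing all
the considerations for the last term in (I.3.34), hence we estimate the above expression using (I.3.54)"*, [II] p. 7) and the
Cauchy-formula bookkeeping — the latter is KERNEL in the tree as `B13Sect1Arith.bound_124` WITH THE REMAINDER BOUND AS ITS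
HYPOTHESIS `hS'`.  THIS FILE discharges `hS'` at FORM level: for an old term `H` analytic (`DifferentiableOn ℂ`) on the ball
of radius `R` about the expansion point in a complex normed configuration space, bounded there by `M` (↔ E₀e^{−κd_j(X)}), and
contour directions `A(t_□, s, σ)` of norm `≤ a < R` (↔ the fluctuation configuration `(tζ̃_□ + t_□ζ_□)𝐇_k(σ(Y₀),B′)` inside the
analyticity domain — the DOMAIN-INCLUSION statement (I.3.36) p. 277, displayed), the n-th order Taylor remainder along the
direction obeys `‖R_n‖ ≤ 2ⁿ·M·(a/R)ⁿ` (iterated Schwarz lemma — the tree's `B11SchwarzRemainder` divided-slope machinery,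
here WITHOUT the "begins at order n" hypothesis: Newton–Taylor at 0 for a general analytic slice, §1–§2), whence (§3) the
(1.23)-functional of the remainder is bounded by `(1/r)·(2ⁿM(a/R)ⁿ)·e^{−(κ₁−1)·#cubes}` (`norm_remPiece_le` =
`B13Sect1Arith.bound_124` ∘ `norm_dirRem_le`).  With n = 5: the shape of (I.3.54) ⊕ (1.24), `(a/R)⁵` ↔ (α₁/α₃)⁵(L^jη)⁵, `1/r` ↔
(1.22) `8B₀C₁e^{16κ₁}α₂⁻¹g_k|B|`, and the (1.25) factor follows by `B13Sect1Arith.bound_125` (G1).  So for the displayed species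
`PieceBound`'s right-hand side is KERNEL modulo (i) the domain inclusion `a < R` with `a/R = (α₁/α₃)·L^jη` ([I] (3.36)–(3.53),
TYPE statements of the inductive spaces — displayed) and (ii) O1 (Bałaban's piece IS this functional of this H).  The OTHER
species (the orders ≤ 4 after [I] §4's Ward–Takahashi reorganisation, gain (L^jη)^{4+β}, `NE9Lemma1Gain`) stay PROOF-INTERIOR.
ADDITIVITY of the functional in `H` (needed to package it as a `PieceData.piece`) is linearity of Taylor remainders and of
integrals — it needs integrability of the contour integrands (continuity in the parameters), an instantiation-side fact not
modelled by `B13Sect1Arith.cauchyOp` (which, like print, bounds the iterated integral with no integrability hypothesis); it is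
NOT asserted here.  DISGUISE TEST: one term, one direction family, one history; a size bound, not NE9.

CONTENT (kernel, 0 sorry; `[folklore]`).
§1 Newton–Taylor at 0 by iterated divided slopes for a GENERAL slice `f : ℂ → F`: `taylorHead f n t = Σ_{m<n} t^m•(tail f m 0)`,
   `eq_taylorHead_add_tail : f t = taylorHead f n t + tⁿ•tail f n t`, `taylorRem`, `taylorRem_eq`.
§2 `norm_tail_le_general : ‖tail f n t‖ ≤ 2ⁿM/rⁿ` on the ball for `f` analytic bounded by `M` (Schwarz on `f − f(0)`, iterated;
   no vanishing-order hypothesis), `norm_taylorRem_le : ‖taylorRem f n t‖ ≤ 2ⁿ·M·(‖t‖/r)ⁿ`.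
§3 along a direction: `dirRem H n A := taylorRem (τ ↦ H(τ•A)) n 1`, **`norm_dirRem_le : ‖dirRem H n A‖ ≤ 2ⁿ·M·(a/R)ⁿ`** for
   `‖A‖ ≤ a < R` — the shape of [I] (3.54)/(3.35) *"O(1)exp(−κd_j(X))(O(1)L^jη)⁵"*.
§4 the (1.23)-functional of the remainder `remPiece` and **`norm_remPiece_le`** = `B13Sect1Arith.bound_124` with `hS'`
   discharged: `≤ (1/r)·(2ⁿ·M·(a/R)ⁿ)·exp(−(κ₁−1)·#cubes)`.

References (TYPES only): [Balaban1987RG1] T. Bałaban, CMP **109** (1987) 249–301, (3.33)–(3.36) p. 277, (3.54) p. 280;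
[Balaban1988RG2Cluster] T. Bałaban, CMP **116** (1988) 1–22, p. 2, (1.22)–(1.25) p. 7.  Summits-side NEW work (LEAN PLACEMENT
RULE); imports the tree's `B13Sect1Arith` (`cauchyOp`, `bound_124`) and `B13ExpansionOrder`/`B11SchwarzRemainder` (`tail`,
`differentiableOn_tail`, `tail_succ'`, `dslope_const_zero`, `tail_zero_fun`) BY NAME; modifies nothing; 0 sorry.  Value = the
displayed species' per-piece bound made kernel at FORM level, NOT summit progress.
-/

noncomputable section

namespace Summit.QuantumFields.BalabanUV.T4Continuum.NE9Lemma1RemainderPiece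

open scoped BigOperators
open Metric Set Complex
open Literature.MathematicalPhysics.QuantumFieldTheory.Balaban1983to89
open Literature.MathematicalPhysics.QuantumFieldTheory.Balaban1983to89.B11SchwarzRemainder
  (tail leadCoeff tail_zero tail_succ tail_succ' differentiableOn_tail)
open Literature.MathematicalPhysics.QuantumFieldTheory.Balaban1983to89.B13ExpansionOrder (dslope_const_zero tail_zero_fun)

variable {F : Type*} [NormedAddCommGroup F] [NormedSpace ℂ F]

/-! ## §1 Newton–Taylor at 0 by iterated divided slopes (general analytic slice, no vanishing order) -/

/-- The Taylor head of order `n` at `0` in Newton form: `Σ_{m<n} t^m • (m-th iterated divided slope at 0)` — for an analytic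
`f` the m-th iterated divided slope at 0 is the m-th Taylor coefficient. [folklore] -/
def taylorHead (f : ℂ → F) (n : ℕ) (t : ℂ) : F := ∑ m ∈ Finset.range n, t ^ m • tail f m 0

/-- The order-`n` Taylor remainder at `0`: `f t − taylorHead f n t`. [folklore] -/
def taylorRem (f : ℂ → F) (n : ℕ) (t : ℂ) : F := f t - taylorHead f n t

/-- **NEWTON–TAYLOR IDENTITY**: `f t = Σ_{m<n} t^m•(tail f m 0) + tⁿ•(tail f n t)` for EVERY `f : ℂ → F` and every `t`
(pure algebra of divided slopes: `tail f m t = tail f m 0 + t•tail f (m+1) t`, Mathlib `sub_smul_dslope`). [folklore] -/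
theorem eq_taylorHead_add_tail (f : ℂ → F) (n : ℕ) (t : ℂ) : f t = taylorHead f n t + t ^ n • tail f n t := by
  induction n with
  | zero => simp [taylorHead]
  | succ n ih =>
    have hstep : tail f n t = tail f n 0 + t • tail f (n + 1) t := by
      have h := sub_smul_dslope (tail f n) 0 t
      rw [sub_zero, ← tail_succ] at h
      rw [h]; abel
    have hsum : taylorHead f (n + 1) t = taylorHead f n t + t ^ n • tail f n 0 := by
      simp only [taylorHead, Finset.sum_range_succ]
    rw [hsum, ih, hstep, smul_add, smul_smul, ← pow_succ]
    abel

/-- The remainder in closed form: `taylorRem f n t = tⁿ • tail f n t`. [folklore] -/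
theorem taylorRem_eq (f : ℂ → F) (n : ℕ) (t : ℂ) : taylorRem f n t = t ^ n • tail f n t := by
  rw [taylorRem, eq_taylorHead_add_tail f n t, add_sub_cancel_left]

/-- The remainder is additive in the function (Taylor heads are linear): not needed for the bound, recorded for the
instantiation (`tail` is additive because `dslope` is). [folklore] -/
theorem taylorRem_zero_order (f : ℂ → F) (t : ℂ) : taylorRem f 0 t = f t := by
  simp [taylorRem, taylorHead]

/-! ## §2 Bounds: iterated Schwarz WITHOUT a vanishing-order hypothesis -/

section Bounds

variable [CompleteSpace F]

/-- **ITERATED SCHWARZ FOR A GENERAL ANALYTIC SLICE**: `f` analytic on `|t| < r` with `‖f‖ ≤ M` there ⟹ the n-th iterated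
divided slope is bounded by `2ⁿ·M/rⁿ` on the disc (step: `g − g(0)` maps the disc into the closed ball of radius `2·sup‖g‖`,
Mathlib `Complex.norm_dslope_le_div_of_mapsTo_ball`; the factor 2 per order is the price of not assuming `f = O(tⁿ)`).
[folklore] -/
theorem norm_tail_le_general {r : ℝ} (hr : 0 < r) :
    ∀ (n : ℕ) (M : ℝ) (f : ℂ → F), DifferentiableOn ℂ f (ball 0 r) → (∀ t ∈ ball (0 : ℂ) r, ‖f t‖ ≤ M) →
      ∀ t ∈ ball (0 : ℂ) r, ‖tail f n t‖ ≤ 2 ^ n * M / r ^ n := by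
  intro n
  induction n with
  | zero =>
    intro M f _ hM t ht
    simpa using hM t ht
  | succ n ih =>
    intro M f hd hM t ht
    -- the n-th tail is analytic and bounded by Bₙ := 2ⁿM/rⁿ; its divided slope at 0 is bounded by 2Bₙ/r
    have hdn : DifferentiableOn ℂ (tail f n) (ball 0 r) := differentiableOn_tail hr hd n
    have hBn : ∀ s ∈ ball (0 : ℂ) r, ‖tail f n s‖ ≤ 2 ^ n * M / r ^ n := ih M f hd hM
    have hmaps : MapsTo (tail f n) (ball (0 : ℂ) r) (closedBall (tail f n 0) (2 * (2 ^ n * M / r ^ n))) := by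
      intro s hs
      rw [mem_closedBall, dist_eq_norm]
      calc ‖tail f n s - tail f n 0‖ ≤ ‖tail f n s‖ + ‖tail f n 0‖ := norm_sub_le _ _
        _ ≤ 2 ^ n * M / r ^ n + 2 ^ n * M / r ^ n := add_le_add (hBn s hs) (hBn 0 (mem_ball_self hr))
        _ = 2 * (2 ^ n * M / r ^ n) := by ring
    have h := Complex.norm_dslope_le_div_of_mapsTo_ball hdn hmaps ht
    rw [tail_succ]
    calc ‖dslope (tail f n) 0 t‖ ≤ 2 * (2 ^ n * M / r ^ n) / r := h
      _ = 2 ^ (n + 1) * M / r ^ (n + 1) := by rw [pow_succ, pow_succ]; field_simp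

/-- **THE TAYLOR REMAINDER BOUND**: `‖taylorRem f n t‖ ≤ 2ⁿ·M·(‖t‖/r)ⁿ` on the disc. [folklore] -/
theorem norm_taylorRem_le {r M : ℝ} {n : ℕ} {f : ℂ → F} (hd : DifferentiableOn ℂ f (ball 0 r))
    (hM : ∀ t ∈ ball (0 : ℂ) r, ‖f t‖ ≤ M) {t : ℂ} (ht : t ∈ ball (0 : ℂ) r) :
    ‖taylorRem f n t‖ ≤ 2 ^ n * M * (‖t‖ / r) ^ n := by
  have hr : 0 < r := lt_of_le_of_lt (norm_nonneg t) (mem_ball_zero_iff.mp ht)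
  rw [taylorRem_eq, norm_smul, norm_pow]
  have htail := norm_tail_le_general hr n M f hd hM t ht
  have hM0 : 0 ≤ M := (norm_nonneg _).trans (hM 0 (mem_ball_self hr))
  calc ‖t‖ ^ n * ‖tail f n t‖ ≤ ‖t‖ ^ n * (2 ^ n * M / r ^ n) :=
        mul_le_mul_of_nonneg_left htail (pow_nonneg (norm_nonneg t) n)
    _ = 2 ^ n * M * (‖t‖ / r) ^ n := by rw [div_pow]; field_simp

end Bounds

/-! ## §3 The remainder along a direction in a complex normed configuration space — the shape of [I] (3.54)/(3.35) -/

section Direction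

variable {E : Type*} [NormedAddCommGroup E] [NormedSpace ℂ E] [CompleteSpace F]

/-- The order-`n` Taylor remainder of `H` at the expansion point `0` ALONG THE DIRECTION `A`, evaluated at the direction
itself: `R_n[τ ↦ H(τ•A)](1)` — for n = 5 the reading of *"the last term in the expansion (3.34)"* of [I] p. 277 (the
fifth-order remainder of `B ↦ 𝐄^{(j)}(X, U_j(□₀, exp iB))` in the direction B). [cite: Balaban1987RG1, (3.34) p.277] -/
def dirRem (H : E → F) (n : ℕ) (A : E) : F := taylorRem (fun τ : ℂ => H (τ • A)) n 1

omit [CompleteSpace F] in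
/-- The slice `τ ↦ H(τ•A)` is analytic on `|τ| < R/‖A‖` when `H` is analytic on the ball of radius `R` (`A ≠ 0`).
[folklore] -/
theorem differentiableOn_dirSlice {H : E → F} {R : ℝ} (hH : DifferentiableOn ℂ H (ball 0 R)) {A : E} (hA : A ≠ 0) :
    DifferentiableOn ℂ (fun τ : ℂ => H (τ • A)) (ball 0 (R / ‖A‖)) := by
  have hAn : 0 < ‖A‖ := norm_pos_iff.mpr hA
  refine hH.comp ((differentiableOn_id.smul_const A)) fun τ hτ => ?_
  rw [mem_ball_zero_iff] at hτ ⊢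
  rw [norm_smul]
  calc ‖τ‖ * ‖A‖ < R / ‖A‖ * ‖A‖ := mul_lt_mul_of_pos_right hτ hAn
    _ = R := div_mul_cancel₀ R hAn.ne'

/-- **THE REMAINDER BOUND ALONG A DIRECTION** — the shape of [I] (3.54)/(3.35) (*"O(1)exp(−κd_j(X))(O(1)L^jη)⁵"*): for `H`
analytic on the ball `‖z‖ < R` with `‖H z‖ ≤ M` there and a direction with `‖A‖ ≤ a < R`,
`‖dirRem H n A‖ ≤ 2ⁿ·M·(a/R)ⁿ`.  (In print `M ↔ E₀e^{−κd_j(X)}` by (1.18), `a/R ↔ (α₁/α₃)·L^jη`: the field is small on fine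
scales relative to the analyticity radius — the DOMAIN-INCLUSION statement (3.36) p. 277, displayed.)
[cite: Balaban1987RG1, (3.54) p.280] -/
theorem norm_dirRem_le {H : E → F} {R M a : ℝ} {n : ℕ} (hH : DifferentiableOn ℂ H (ball 0 R))
    (hM : ∀ z ∈ ball (0 : E) R, ‖H z‖ ≤ M) {A : E} (hAa : ‖A‖ ≤ a) (haR : a < R) :
    ‖dirRem H n A‖ ≤ 2 ^ n * M * (a / R) ^ n := by
  have hR : 0 < R := lt_of_le_of_lt ((norm_nonneg A).trans hAa) haR
  have ha0 : 0 ≤ a := (norm_nonneg A).trans hAa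
  have hM0 : 0 ≤ M := (norm_nonneg _).trans (hM 0 (mem_ball_self hR))
  by_cases hA : A = 0
  · -- constant slice: the remainder is H 0 at order 0 and vanishes at every positive order
    subst hA
    unfold dirRem
    cases n with
    | zero =>
      rw [taylorRem_zero_order]
      simpa using hM 0 (mem_ball_self hR)
    | succ n =>
      have hconst : (fun τ : ℂ => H (τ • (0 : E))) = fun _ => H 0 := by funext τ; rw [smul_zero]
      rw [taylorRem_eq, hconst, tail_succ', dslope_const_zero, tail_zero_fun]
      simp only [Pi.zero_apply, smul_zero, norm_zero]
      positivity
  · have hAn : 0 < ‖A‖ := norm_pos_iff.mpr hA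
    have hd := differentiableOn_dirSlice hH hA
    have hMs : ∀ τ ∈ ball (0 : ℂ) (R / ‖A‖), ‖(fun τ : ℂ => H (τ • A)) τ‖ ≤ M := by
      intro τ hτ
      refine hM _ ?_
      rw [mem_ball_zero_iff] at hτ ⊢
      rw [norm_smul]
      calc ‖τ‖ * ‖A‖ < R / ‖A‖ * ‖A‖ := mul_lt_mul_of_pos_right hτ hAn
        _ = R := div_mul_cancel₀ R hAn.ne'
    have h1 : (1 : ℂ) ∈ ball (0 : ℂ) (R / ‖A‖) := by
      rw [mem_ball_zero_iff, norm_one, lt_div_iff₀ hAn, one_mul]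
      exact lt_of_le_of_lt hAa haR
    have h := norm_taylorRem_le (n := n) hd hMs h1
    unfold dirRem
    refine h.trans ?_
    rw [norm_one, one_div_div]
    have hratio : ‖A‖ / R ≤ a / R := div_le_div_of_nonneg_right hAa hR.le
    exact mul_le_mul_of_nonneg_left (pow_le_pow_left₀ (div_nonneg hAn.le hR.le) hratio n)
      (mul_nonneg (pow_nonneg (by norm_num) n) hM0)

end Direction

/-! ## §4 The (1.23)-functional of the remainder: `B13Sect1Arith.bound_124` with its hypothesis discharged -/

section Piece

variable {E : Type*} [NormedAddCommGroup E] [NormedSpace ℂ E] [CompleteSpace F] {ι : Type*} [DecidableEq ι]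

/-- THE (1.23)-FUNCTIONAL OF THE REMAINDER (the displayed piece of [II] §1 at FORM level): the t_□-circle of radius `r` and the
iterated `∫₀¹ds(Δ)(2πi)⁻¹∮_{|σ(Δ)|=ρ}dσ(Δ)/(σ(Δ)−s(Δ))²` over the cubes `l` (`B13Sect1Arith.cauchyOp`), applied to the order-`n`
remainder of the old term `H` along the contour direction `A(t_□, s, σ)` (↔ `(tζ̃_□ + t_□ζ_□)𝐇_k(σ(Y₀),B′)`, (1.1)/(1.23)).
[cite: Balaban1988RG2Cluster, (1.23) p.7] -/
def remPiece (ρ r : ℝ) (l : List ι) (H : E → F) (n : ℕ) (A : ℂ → (ι → ℝ) → (ι → ℂ) → E)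
    (s : ι → ℝ) (σ : ι → ℂ) : F :=
  (2 * Real.pi * I : ℂ)⁻¹ • ∮ t in C(0, r), (t ^ 2)⁻¹ •
    B13Sect1Arith.cauchyOp ρ l (fun s' σ' => dirRem H n (A t s' σ')) s σ

/-- **THE DISPLAYED SPECIES' PER-PIECE BOUND AT FORM LEVEL** ((I.3.54) ⊕ [II] (1.24)): with `ρ = e^{κ₁}`, `κ₁ ≥ 1`, the
t_□-radius `r > 0` ((1.22): `1/r = 8B₀C₁e^{16κ₁}α₂⁻¹g_k|B|`), an old term `H` analytic on the ball of radius `R` and bounded by `M`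
there (↔ (1.18): E₀e^{−κd_j(X)}), and contour directions of norm `≤ a < R` on the contours ((I.3.36): `a/R ↔ (α₁/α₃)L^jη`), the
(1.23)-functional of the order-n remainder is bounded by `(1/r)·(2ⁿ·M·(a/R)ⁿ)·exp(−(κ₁−1)·#cubes)` — `B13Sect1Arith.bound_124`
with its remainder hypothesis `hS'` DISCHARGED by `norm_dirRem_le`; n = 5 is the printed case, and (1.25) follows by
`B13Sect1Arith.bound_125`. [cite: Balaban1988RG2Cluster, (1.24) p.7] -/
theorem norm_remPiece_le {κ₁ r R M a : ℝ} {n : ℕ} (hκ : 1 ≤ κ₁) (hr : 0 < r) {H : E → F}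
    (hH : DifferentiableOn ℂ H (ball 0 R)) (hM : ∀ z ∈ ball (0 : E) R, ‖H z‖ ≤ M) (haR : a < R)
    (l : List ι) (A : ℂ → (ι → ℝ) → (ι → ℂ) → E)
    (hA : ∀ t ∈ Metric.sphere (0:ℂ) r, ∀ s σ,
      (∀ i ∈ l, s i ∈ Set.Icc (0:ℝ) 1 ∧ σ i ∈ Metric.sphere (0:ℂ) (Real.exp κ₁)) → ‖A t s σ‖ ≤ a)
    (s : ι → ℝ) (σ : ι → ℂ) (hsσ : ∀ i ∈ l, s i ∈ Set.Icc (0:ℝ) 1 ∧ σ i ∈ Metric.sphere (0:ℂ) (Real.exp κ₁)) :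
    ‖remPiece (Real.exp κ₁) r l H n A s σ‖ ≤ (1 / r) * (2 ^ n * M * (a / R) ^ n) * Real.exp (-(κ₁ - 1) * l.length) := by
  -- the remainder bound on the contours
  have hS' : ∀ t ∈ Metric.sphere (0:ℂ) r, ∀ s σ,
      (∀ i ∈ l, s i ∈ Set.Icc (0:ℝ) 1 ∧ σ i ∈ Metric.sphere (0:ℂ) (Real.exp κ₁)) →
        ‖dirRem H n (A t s σ)‖ ≤ 2 ^ n * M * (a / R) ^ n :=
    fun t ht s σ hsσ => norm_dirRem_le hH hM (hA t ht s σ hsσ) haR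
  -- nonnegativity of the bound, read off at one admissible contour point (t = r, s ≡ 0, σ ≡ e^{κ₁})
  have hS0 : 0 ≤ 2 ^ n * M * (a / R) ^ n := by
    have ht : ((r : ℝ) : ℂ) ∈ Metric.sphere (0:ℂ) r := by simp [abs_of_pos hr]
    have hpar : ∀ i ∈ l, (fun _ : ι => (0:ℝ)) i ∈ Set.Icc (0:ℝ) 1 ∧
        (fun _ : ι => ((Real.exp κ₁ : ℝ) : ℂ)) i ∈ Metric.sphere (0:ℂ) (Real.exp κ₁) := by
      intro i _
      refine ⟨⟨le_rfl, zero_le_one⟩, ?_⟩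
      simp
    exact (norm_nonneg _).trans (hS' _ ht _ _ hpar)
  exact B13Sect1Arith.bound_124 hκ hr hS0 l (fun t s' σ' => dirRem H n (A t s' σ')) hS' s σ hsσ

/-- The printed case n = 5 spelled out: `‖remPiece … 5 …‖ ≤ (1/r)·(32·M·(a/R)⁵)·exp(−(κ₁−1)·#cubes)` — (1.24)'s
`8B₀C₁e^{16κ₁}α₂⁻¹g_k|B| · E₀(α₁/α₃)⁵(L^jη)⁵ · exp(−(κ₁−1)M⁻⁴|Y₀∖□̃⁴|) · exp(−κd_j(X))` with the unprinted absolute factor 2⁵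
of the iterated Schwarz lemma in place of print's O(1). [cite: Balaban1988RG2Cluster, (1.24) p.7] -/
theorem norm_remPiece_five_le {κ₁ r R M a : ℝ} (hκ : 1 ≤ κ₁) (hr : 0 < r) {H : E → F}
    (hH : DifferentiableOn ℂ H (ball 0 R)) (hM : ∀ z ∈ ball (0 : E) R, ‖H z‖ ≤ M) (haR : a < R)
    (l : List ι) (A : ℂ → (ι → ℝ) → (ι → ℂ) → E)
    (hA : ∀ t ∈ Metric.sphere (0:ℂ) r, ∀ s σ,
      (∀ i ∈ l, s i ∈ Set.Icc (0:ℝ) 1 ∧ σ i ∈ Metric.sphere (0:ℂ) (Real.exp κ₁)) → ‖A t s σ‖ ≤ a)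
    (s : ι → ℝ) (σ : ι → ℂ) (hsσ : ∀ i ∈ l, s i ∈ Set.Icc (0:ℝ) 1 ∧ σ i ∈ Metric.sphere (0:ℂ) (Real.exp κ₁)) :
    ‖remPiece (Real.exp κ₁) r l H 5 A s σ‖ ≤ (1 / r) * (32 * M * (a / R) ^ 5) * Real.exp (-(κ₁ - 1) * l.length) := by
  have h := norm_remPiece_le (n := 5) hκ hr hH hM haR l A hA s σ hsσ
  have h32 : (2:ℝ) ^ 5 = 32 := by norm_num
  rw [h32] at h
  exact h

end Piece

end Summit.QuantumFields.BalabanUV.T4Continuum.NE9Lemma1RemainderPiece
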